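import Literature.GroupTheory.CombinatorialGroupTheory.PuncturedSurfaceGroupUnrQuotientCoprod
import HarnessLib

/-!
# The unramified quotient of the IRREDUCIBLE `k`-nodal degeneration: `Γ_{k+g,r}/⟨⟨b_m (m<k), c_j⟩⟩ ≅ Γ_{g,0} ∗ F_k`

Topic `Literature/GroupTheory/CombinatorialGroupTheory`; theorems only (a Tietze computation).  [CombGC]
Def. 1.1 (ii) p. 7 (the unramified quotient `Π^unr_G`) [cite: MochizukiCombGC2007, Def 1.1(ii) p.7] at the
IRREDUCIBLE `k`-NODAL data of abc-iut-f-164 gen 2 (`PSCIrreducibleMultiNodalShape.lean` /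
`PSCIrreducibleMultiNodalOrigin.lean`: an irreducible pointed stable curve with `k` nodes — dual semi-graph a
single vertex with `k` LOOPS —, `Γ_{k+g,r}` the smoothing, node loops the non-separating simple closed curves
`b_m`, `m < k`, stable letters `a_m`).  Killing every cusp generator `c_j` and every node loop `b_m` kills the
commutators `[a_m, b_m]` and then, by the relator, `∏_{i≥k}[a_i,b_i]`; what is left is the free product of the
CLOSED surface group on the handles `i ≥ k` with the FREE group on the `k` stable letters — the `π₁` of the
compact irreducible `k`-nodal curve, whose dual graph has first Betti number `k`.

* `exists_mulEquiv_multiNodalUnrQuotient_coprod` — an isomorphism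
  `Γ_{k+g,r} ⧸ ⟨⟨{b_m : m < k} ∪ {c_j}⟩⟩ ≃* Γ_{g,0} ∗ F_k` (`Monoid.Coprod`, `F_k = FreeGroup (Fin k)`) with
  `[a_{k+j}] ↦ inl a_j`, `[b_{k+j}] ↦ inl b_j`, `[a_m] ↦ inr x_m` (`m < k`).

Generalises the one-node case `PuncturedSurfaceGroupIrrNodalUnrQuotientCoprod.lean` (`k = 1`, `F_1 ≅ ℤ`).
Step (i) of the `Π^unr`-separating-covering programme at the deeper strata of `Δ_irr`; elementary; nothing
here concerns [IUTchIII].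
-/

namespace Literature.GroupTheory.CombinatorialGroupTheory

namespace PuncturedSurfaceGroup

open Monoid (Coprod)

/-- **`Γ_{k+g,r} ⧸ ⟨⟨b_m (m<k), c_0, …, c_{r−1}⟩⟩ ≅ Γ_{g,0} ∗ F_k`** for the node loops `b_m` of the irreducible
`k`-nodal degeneration: the handles `i ≥ k` go to the closed surface group, the stable letters `a_m` to the
free factor. [cite: MochizukiCombGC2007, Def 1.1(ii) p.7] -/
theorem exists_mulEquiv_multiNodalUnrQuotient_coprod (k g r : ℕ) :
    ∃ (_hK : (Subgroup.normalClosure (Set.range (fun m : Fin k => b (r := r) (Fin.castAdd g m)) ∪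
        Set.range (c : Fin r → PuncturedSurfaceGroup (k + g) r))).Normal)
      (e : PuncturedSurfaceGroup (k + g) r ⧸
          Subgroup.normalClosure (Set.range (fun m : Fin k => b (r := r) (Fin.castAdd g m)) ∪
            Set.range (c : Fin r → PuncturedSurfaceGroup (k + g) r)) ≃*
        Coprod (PuncturedSurfaceGroup g 0) (FreeGroup (Fin k))),
      (∀ (j : Fin g) (bit : Bool),
        e (QuotientGroup.mk (PresentedGroup.of (Sum.inl (Fin.natAdd k j, bit)))) =
          Coprod.inl (PresentedGroup.of (Sum.inl (j, bit)))) ∧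
      ∀ m : Fin k, e (QuotientGroup.mk (a (r := r) (Fin.castAdd g m))) = Coprod.inr (FreeGroup.of m) := by
  classical
  set K : Subgroup (PuncturedSurfaceGroup (k + g) r) :=
    Subgroup.normalClosure (Set.range (fun m : Fin k => b (r := r) (Fin.castAdd g m)) ∪
      Set.range (c : Fin r → PuncturedSurfaceGroup (k + g) r)) with hKdef
  haveI hKn : K.Normal := Subgroup.normalClosure_normal
  have hcK : ∀ j, c (g := k + g) (r := r) j ∈ K := fun j =>
    Subgroup.subset_normalClosure (Or.inr ⟨j, rfl⟩)
  have hbK : ∀ m : Fin k, b (r := r) (Fin.castAdd g m) ∈ K := fun m =>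
    Subgroup.subset_normalClosure (Or.inl ⟨m, rfl⟩)
  have hcommK : ∀ m : Fin k, a (r := r) (Fin.castAdd g m) * b (Fin.castAdd g m) * (a (Fin.castAdd g m))⁻¹ *
      (b (Fin.castAdd g m))⁻¹ ∈ K := fun m =>
    K.mul_mem (by simpa using hKn.conj_mem _ (hbK m) (a (r := r) (Fin.castAdd g m))) (K.inv_mem (hbK m))
  -- the two blocks of the relator
  set X : PuncturedSurfaceGroup (k + g) r := ((List.finRange k).map fun m : Fin k =>
      a (r := r) (Fin.castAdd g m) * b (Fin.castAdd g m) * (a (Fin.castAdd g m))⁻¹ * (b (Fin.castAdd g m))⁻¹).prod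
    with hX
  set Y : PuncturedSurfaceGroup (k + g) r := ((List.finRange g).map fun j : Fin g =>
      a (r := r) (Fin.natAdd k j) * b (Fin.natAdd k j) * (a (Fin.natAdd k j))⁻¹ * (b (Fin.natAdd k j))⁻¹).prod
    with hY
  have hrel : X * Y * ((List.finRange r).map fun j : Fin r => c (g := k + g) j).prod = 1 := by
    have h := comm_prod_mul_cusp_prod_eq_one (g := k + g) (r := r)
    rw [prod_map_finRange_add] at h
    exact h
  have hXK : X ∈ K := Subgroup.list_prod_mem _ fun y hy => by
    obtain ⟨m, -, rfl⟩ := List.mem_map.mp hy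
    exact hcommK m
  have hCK : ((List.finRange r).map fun j : Fin r => c (g := k + g) j).prod ∈ K :=
    Subgroup.list_prod_mem _ fun y hy => by
      obtain ⟨j, -, rfl⟩ := List.mem_map.mp hy
      exact hcK j
  have hYK : Y ∈ K := by
    have hYe : Y = X⁻¹ * (((List.finRange r).map fun j : Fin r => c (g := k + g) j).prod)⁻¹ := by
      have h1 : Y * ((List.finRange r).map fun j : Fin r => c (g := k + g) j).prod = X⁻¹ :=
        eq_inv_of_mul_eq_one_right (by rw [← mul_assoc]; exact hrel)
      rw [← h1, mul_inv_cancel_right]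
    rw [hYe]
    exact K.mul_mem (K.inv_mem hXK) (K.inv_mem hCK)
  -- (1) `Φ : Γ → Γ_{g,0} ∗ F_k`
  let fA : Fin (k + g) → Bool → Coprod (PuncturedSurfaceGroup g 0) (FreeGroup (Fin k)) :=
    Fin.addCases (motive := fun _ => Bool → Coprod (PuncturedSurfaceGroup g 0) (FreeGroup (Fin k)))
      (fun m bit => if bit then 1 else Coprod.inr (FreeGroup.of m))
      (fun j bit => Coprod.inl (PresentedGroup.of (Sum.inl (j, bit))))
  have hfA_left : ∀ m bit, fA (Fin.castAdd g m) bit = if bit then 1 else Coprod.inr (FreeGroup.of m) :=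
    fun m bit => by simp only [fA, Fin.addCases_left]
  have hfA_right : ∀ j bit, fA (Fin.natAdd k j) bit = Coprod.inl (PresentedGroup.of (Sum.inl (j, bit))) :=
    fun j bit => by simp only [fA, Fin.addCases_right]
  let f : puncturedSurfaceGen (k + g) r → Coprod (PuncturedSurfaceGroup g 0) (FreeGroup (Fin k)) :=
    Sum.elim (fun q => fA q.1 q.2) fun _ => 1
  have hcommS : ∀ j : Fin g, f (Sum.inl (Fin.natAdd k j, false)) * f (Sum.inl (Fin.natAdd k j, true)) *
      (f (Sum.inl (Fin.natAdd k j, false)))⁻¹ * (f (Sum.inl (Fin.natAdd k j, true)))⁻¹ =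
      Coprod.inl (a (r := 0) j * b j * (a j)⁻¹ * (b j)⁻¹) := fun j => by
    simp only [f, Sum.elim_inl, hfA_right, map_mul, map_inv]; rfl
  have hfrel : ∀ v ∈ ({relator (k + g) r} : Set (FreeGroup (puncturedSurfaceGen (k + g) r))),
      FreeGroup.lift f v = 1 := by
    intro v hv
    rw [Set.mem_singleton_iff] at hv
    rw [hv, lift_relator, prod_map_finRange_add]
    have h3 : ((List.finRange r).map fun j => f (Sum.inr j)).prod = 1 :=
      List.prod_eq_one fun y hy => by
        obtain ⟨j, -, rfl⟩ := List.mem_map.mp hy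
        rfl
    have h0 : ((List.finRange k).map fun m : Fin k => (fun i : Fin (k + g) =>
        f (Sum.inl (i, false)) * f (Sum.inl (i, true)) * (f (Sum.inl (i, false)))⁻¹ *
          (f (Sum.inl (i, true)))⁻¹) (Fin.castAdd g m)).prod = 1 :=
      List.prod_eq_one fun y hy => by
        obtain ⟨m, -, rfl⟩ := List.mem_map.mp hy
        simp only [f, Sum.elim_inl, hfA_left, if_true]
        simp
    have h1 : ((List.finRange g).map fun j : Fin g => (fun i : Fin (k + g) =>
        f (Sum.inl (i, false)) * f (Sum.inl (i, true)) * (f (Sum.inl (i, false)))⁻¹ *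
          (f (Sum.inl (i, true)))⁻¹) (Fin.natAdd k j)).prod = 1 := by
      rw [show (fun j : Fin g => (fun i : Fin (k + g) =>
          f (Sum.inl (i, false)) * f (Sum.inl (i, true)) * (f (Sum.inl (i, false)))⁻¹ *
            (f (Sum.inl (i, true)))⁻¹) (Fin.natAdd k j)) =
          (Coprod.inl : PuncturedSurfaceGroup g 0 →* Coprod (PuncturedSurfaceGroup g 0) (FreeGroup (Fin k))) ∘
            fun j => a (r := 0) j * b j * (a j)⁻¹ * (b j)⁻¹
          from funext fun j => hcommS j, ← List.map_map, ← map_list_prod, comm_prod_eq_one_zero, map_one]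
    rw [h0, h1, h3, one_mul, one_mul]
  let Φ : PuncturedSurfaceGroup (k + g) r →* Coprod (PuncturedSurfaceGroup g 0) (FreeGroup (Fin k)) :=
    PresentedGroup.toGroup hfrel
  have hΦof : ∀ x, Φ (PresentedGroup.of x) = f x := fun x => PresentedGroup.toGroup.of hfrel
  have hΦam : ∀ m : Fin k, Φ (a (Fin.castAdd g m)) = Coprod.inr (FreeGroup.of m) := fun m => by
    rw [a, hΦof]; simp only [f, Sum.elim_inl, hfA_left]; rfl
  have hΦbm : ∀ m : Fin k, Φ (b (Fin.castAdd g m)) = 1 := fun m => by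
    rw [b, hΦof]; simp only [f, Sum.elim_inl, hfA_left, if_true]
  have hΦs : ∀ (j : Fin g) (bit : Bool), Φ (PresentedGroup.of (Sum.inl (Fin.natAdd k j, bit))) =
      Coprod.inl (PresentedGroup.of (Sum.inl (j, bit))) := fun j bit => by
    rw [hΦof]; simp only [f, Sum.elim_inl, hfA_right]
  have hΦc : ∀ j, Φ (c j) = 1 := fun j => hΦof (Sum.inr j)
  have hKΦ : K ≤ Φ.ker := by
    refine Subgroup.normalClosure_le_normal ?_
    rintro x (⟨m, rfl⟩ | ⟨j, rfl⟩)
    · rw [SetLike.mem_coe, MonoidHom.mem_ker]; exact hΦbm m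
    · rw [SetLike.mem_coe, MonoidHom.mem_ker]; exact hΦc j
  let Φb : PuncturedSurfaceGroup (k + g) r ⧸ K →* Coprod (PuncturedSurfaceGroup g 0) (FreeGroup (Fin k)) :=
    QuotientGroup.lift K Φ hKΦ
  have hΦb : ∀ x : PuncturedSurfaceGroup (k + g) r, Φb (QuotientGroup.mk x) = Φ x := fun x =>
    QuotientGroup.lift_mk' K hKΦ x
  -- (2) `Ψ : Γ_{g,0} ∗ F_k → Γ/K`
  let f₀ : puncturedSurfaceGen g 0 → PuncturedSurfaceGroup (k + g) r ⧸ K :=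
    Sum.elim (fun q => QuotientGroup.mk (PresentedGroup.of (Sum.inl (Fin.natAdd k q.1, q.2)))) Fin.elim0
  have hf₀rel : ∀ v ∈ ({relator g 0} : Set (FreeGroup (puncturedSurfaceGen g 0))),
      FreeGroup.lift f₀ v = 1 := by
    intro v hv
    rw [Set.mem_singleton_iff] at hv
    rw [hv, lift_relator, List.finRange_zero, List.map_nil, List.prod_nil, mul_one]
    have : (fun j : Fin g => f₀ (Sum.inl (j, false)) * f₀ (Sum.inl (j, true)) * (f₀ (Sum.inl (j, false)))⁻¹ *
        (f₀ (Sum.inl (j, true)))⁻¹) = (QuotientGroup.mk' K) ∘ fun j => a (r := r) (Fin.natAdd k j) *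
          b (Fin.natAdd k j) * (a (Fin.natAdd k j))⁻¹ * (b (Fin.natAdd k j))⁻¹ := by
      funext j; simp only [f₀, Sum.elim_inl, Function.comp_apply, map_mul, map_inv]; rfl
    rw [this, ← List.map_map, ← map_list_prod, ← hY, QuotientGroup.mk'_apply, QuotientGroup.eq_one_iff]
    exact hYK
  let ψ₀ : PuncturedSurfaceGroup g 0 →* PuncturedSurfaceGroup (k + g) r ⧸ K := PresentedGroup.toGroup hf₀rel
  have hψ₀ : ∀ (j : Fin g) (bit : Bool), ψ₀ (PresentedGroup.of (Sum.inl (j, bit))) =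
      QuotientGroup.mk (PresentedGroup.of (Sum.inl (Fin.natAdd k j, bit))) :=
    fun j bit => PresentedGroup.toGroup.of hf₀rel
  let ψ₁ : FreeGroup (Fin k) →* PuncturedSurfaceGroup (k + g) r ⧸ K :=
    FreeGroup.lift fun m => QuotientGroup.mk (a (r := r) (Fin.castAdd g m))
  have hψ₁ : ∀ m : Fin k, ψ₁ (FreeGroup.of m) = QuotientGroup.mk (a (r := r) (Fin.castAdd g m)) :=
    fun m => FreeGroup.lift_apply_of
  let Ψ : Coprod (PuncturedSurfaceGroup g 0) (FreeGroup (Fin k)) →* PuncturedSurfaceGroup (k + g) r ⧸ K :=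
    Coprod.lift ψ₀ ψ₁
  -- (3) the two compositions
  have h1 : Ψ.comp Φb = MonoidHom.id _ := by
    refine QuotientGroup.monoidHom_ext _ (PresentedGroup.ext fun x => ?_)
    change Ψ (Φb (QuotientGroup.mk (PresentedGroup.of x))) = QuotientGroup.mk (PresentedGroup.of x)
    rw [hΦb]
    rcases x with ⟨i, bit⟩ | j
    · induction i using Fin.addCases with
      | left m =>
        cases bit
        · change Ψ (Φ (a (Fin.castAdd g m))) = QuotientGroup.mk (a (Fin.castAdd g m))
          rw [hΦam]
          show Coprod.lift ψ₀ ψ₁ (Coprod.inr _) = _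
          rw [Coprod.lift_apply_inr, hψ₁]
        · change Ψ (Φ (b (Fin.castAdd g m))) = QuotientGroup.mk (b (Fin.castAdd g m))
          rw [hΦbm, map_one, eq_comm, QuotientGroup.eq_one_iff]
          exact hbK m
      | right j =>
        rw [hΦs]
        show Coprod.lift ψ₀ ψ₁ (Coprod.inl _) = _
        rw [Coprod.lift_apply_inl, hψ₀]
    · change Ψ (Φ (c j)) = QuotientGroup.mk (c j)
      rw [hΦc, map_one, eq_comm, QuotientGroup.eq_one_iff]
      exact hcK j
  have h2 : Φb.comp Ψ = MonoidHom.id _ := by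
    refine Coprod.hom_ext (PresentedGroup.ext fun y => ?_) (FreeGroup.ext_hom _ _ fun m => ?_)
    · change Φb (Ψ (Coprod.inl (PresentedGroup.of y))) = Coprod.inl (PresentedGroup.of y)
      rcases y with ⟨j, bit⟩ | j
      · show Φb (Coprod.lift ψ₀ ψ₁ (Coprod.inl (PresentedGroup.of _))) = _
        rw [Coprod.lift_apply_inl, hψ₀, hΦb, hΦs]
      · exact Fin.elim0 j
    · change Φb (Ψ (Coprod.inr (FreeGroup.of m))) = Coprod.inr (FreeGroup.of m)
      show Φb (Coprod.lift ψ₀ ψ₁ (Coprod.inr _)) = _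
      rw [Coprod.lift_apply_inr, hψ₁, hΦb, hΦam]
  refine ⟨hKn, MonoidHom.toMulEquiv Φb Ψ h1 h2, fun j bit => ?_, fun m => ?_⟩
  · rw [MonoidHom.toMulEquiv_apply, hΦb, hΦs]
  · rw [MonoidHom.toMulEquiv_apply, hΦb, hΦam]

end PuncturedSurfaceGroup

end Literature.GroupTheory.CombinatorialGroupTheory
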